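import Literature.NumberTheory.Automorphic.MixedSpaceUnitsHaar
import Mathlib.NumberTheory.NumberField.CanonicalEmbedding.Basic
import Mathlib.Analysis.SpecialFunctions.Gamma.Basic
import Mathlib.Analysis.SpecialFunctions.PolarCoord
import Mathlib.MeasureTheory.Integral.IntegralEqImproper
import Mathlib.MeasureTheory.Integral.Pi
import Mathlib.Algebra.Group.Pi.Units
import HarnessLib

/-!
# Integration over `K_∞ˣ = (ℝˣ)^{r₁} × (ℂˣ)^{r₂}`: coordinate units, `d^×x = dx/N(x)`, Fubini,
# and the radial integrals on `ℂ`

Topic `NumberTheory/Automorphic`; namespace `Literature.NumberTheory.Automorphic`. Support file for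
archimedean local zeta / Rankin–Selberg computations in the coordinates `K_∞ = mixedSpace K =
ℝ^{r₁} × ℂ^{r₂}` (Tate (1967), Ch. XV §2.2, §2.5, §4.3: the archimedean factor `∏_v d^×x_v` of the
idelic Haar measure and the special local zeta functions). Everything is proved; the only definitions
(with bodies) are the coordinate unit embeddings `realUnitAt K w : ℝˣ →* K_∞ˣ`,
`complexUnitAt K w : ℂˣ →* K_∞ˣ` and the coordinate units `unitsFstAt`, `unitsSndAt` of a unit.

* `units_eq_prod_coordUnits`, `char_units_eq_prod` — a unit of `K_∞` is the product of its coordinate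
  units, so a character of `K_∞ˣ` is the product of its coordinate characters;
* `ae_isUnit_mixedSpace` — Lebesgue-almost every point of `K_∞` is a unit;
* `integral_mixedUnitsHaar` — **`∫_{K_∞ˣ} G(u) d^×u = ∫_{K_∞} G(x) N(x)⁻¹ dx`** (Bochner form of the
  tree's `lintegral_mixedUnitsHaar`, `MixedSpaceUnitsHaar`), and `exists_integral_units_eq_mul_integral`
  — every Haar measure on `K_∞ˣ` is `c · dx/N(x)`, `c > 0` (uniqueness of Haar measure);
* `integral_mixedSpace_prod_eq_prod` — Fubini: `∫_{K_∞} ∏_w f_w(x_w) ∏_w g_w(z_w) = ∏_w ∫_ℝ f_w ∏_w ∫_ℂ g_w`;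
* `integral_complex_radial` — `∫_ℂ H(|z|) dx dy = 2π ∫₀^∞ r H(r) dr`, and
  `integral_complex_normSq_cpow_mul_exp` — **`∫_ℂ (|z|²)^{a-1} e^{-b|z|²} dx dy = π b^{-a} Γ(a)`**
  (`re a > 0`, `b > 0`; Tate's complex computation of §2.5 with a general Gaussian parameter).

## References

* J. Tate, *Fourier analysis in number fields and Hecke's zeta-functions*, in Cassels–Fröhlich,
  *Algebraic Number Theory* (1967), Ch. XV, §2.2, §2.5, §4.3 [TateThesis1967] [CasselsFrohlichANT1967].
-/

noncomputable section

open MeasureTheory Measure NumberField NumberField.InfinitePlace NumberField.mixedEmbedding Set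
open scoped ENNReal NNReal Classical

namespace Literature.NumberTheory.Automorphic

variable (K : Type*) [Field K] [NumberField K]

/-! ### Coordinate units of `K_∞ˣ` -/

section CoordUnits

/-- The unit of `K_∞` which is `x ∈ ℝˣ` at the real place `w` and `1` elsewhere. [folklore] -/
abbrev realUnitAt (w : {w : InfinitePlace K // IsReal w}) : ℝˣ →* (mixedSpace K)ˣ :=
  Units.map (((MonoidHom.inl ({w : InfinitePlace K // IsReal w} → ℝ) ({w : InfinitePlace K // IsComplex w} → ℂ))).comp
    (MonoidHom.mulSingle (fun _ : {w : InfinitePlace K // IsReal w} => ℝ) w))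

/-- The unit of `K_∞` which is `z ∈ ℂˣ` at the complex place `w` and `1` elsewhere. [folklore] -/
abbrev complexUnitAt (w : {w : InfinitePlace K // IsComplex w}) : ℂˣ →* (mixedSpace K)ˣ :=
  Units.map (((MonoidHom.inr ({w : InfinitePlace K // IsReal w} → ℝ) ({w : InfinitePlace K // IsComplex w} → ℂ))).comp
    (MonoidHom.mulSingle (fun _ : {w : InfinitePlace K // IsComplex w} => ℂ) w))

variable {K}

omit [NumberField K] in
/-- The real coordinates of a unit of `K_∞` are non-zero. [folklore] -/
theorem units_fst_ne_zero (c : (mixedSpace K)ˣ) (w : {w : InfinitePlace K // IsReal w}) :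
    (c : mixedSpace K).1 w ≠ 0 := by
  have h := (Prod.isUnit_iff.mp c.isUnit).1
  exact (h.apply w).ne_zero

omit [NumberField K] in
/-- The complex coordinates of a unit of `K_∞` are non-zero. [folklore] -/
theorem units_snd_ne_zero (c : (mixedSpace K)ˣ) (w : {w : InfinitePlace K // IsComplex w}) :
    (c : mixedSpace K).2 w ≠ 0 := by
  have h := (Prod.isUnit_iff.mp c.isUnit).2
  exact (h.apply w).ne_zero

/-- The real coordinate unit `c_w ∈ ℝˣ` of `c ∈ K_∞ˣ`. [folklore] -/
abbrev unitsFstAt (c : (mixedSpace K)ˣ) (w : {w : InfinitePlace K // IsReal w}) : ℝˣ :=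
  Units.mk0 ((c : mixedSpace K).1 w) (units_fst_ne_zero c w)

/-- The complex coordinate unit `c_w ∈ ℂˣ` of `c ∈ K_∞ˣ`. [folklore] -/
abbrev unitsSndAt (c : (mixedSpace K)ˣ) (w : {w : InfinitePlace K // IsComplex w}) : ℂˣ :=
  Units.mk0 ((c : mixedSpace K).2 w) (units_snd_ne_zero c w)

/-- **A unit of `K_∞` is the product of its coordinate units.** [folklore] -/
theorem units_eq_prod_coordUnits (c : (mixedSpace K)ˣ) :
    c = (∏ w, realUnitAt K w (unitsFstAt c w)) * ∏ w, complexUnitAt K w (unitsSndAt c w) := by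
  refine Units.ext ?_
  rw [Units.val_mul, Units.coe_prod, Units.coe_prod]
  simp only [Units.coe_map, MonoidHom.coe_comp, Function.comp_apply, Units.val_mk0]
  simp only [MonoidHom.mulSingle_apply, MonoidHom.inl_apply, MonoidHom.inr_apply]
  refine Prod.ext ?_ ?_
  · rw [Prod.fst_mul, Prod.fst_prod, Prod.fst_prod, Finset.prod_const_one, mul_one,
      Finset.univ_prod_mulSingle]
  · rw [Prod.snd_mul, Prod.snd_prod, Prod.snd_prod, Finset.prod_const_one, one_mul,
      Finset.univ_prod_mulSingle]

omit [NumberField K] in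
/-- The coordinate units are continuous in the unit. [folklore] -/
theorem continuous_realUnitAt (w : {w : InfinitePlace K // IsReal w}) : Continuous (realUnitAt K w) := by
  refine Continuous.units_map _ ?_
  show Continuous fun x : ℝ => ((Pi.mulSingle w x : {w : InfinitePlace K // IsReal w} → ℝ),
    (1 : {w : InfinitePlace K // IsComplex w} → ℂ))
  exact (continuous_mulSingle (A := fun _ : {w : InfinitePlace K // IsReal w} => ℝ) w).prodMk
    continuous_const

omit [NumberField K] in
/-- The coordinate units are continuous in the unit. [folklore] -/
theorem continuous_complexUnitAt (w : {w : InfinitePlace K // IsComplex w}) : Continuous (complexUnitAt K w) := by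
  refine Continuous.units_map _ ?_
  show Continuous fun z : ℂ => ((1 : {w : InfinitePlace K // IsReal w} → ℝ),
    (Pi.mulSingle w z : {w : InfinitePlace K // IsComplex w} → ℂ))
  exact continuous_const.prodMk
    (continuous_mulSingle (A := fun _ : {w : InfinitePlace K // IsComplex w} => ℂ) w)

/-- **Product formula for a character of `K_∞ˣ`.** [folklore] -/
theorem char_units_eq_prod {M : Type*} [CommMonoid M] (η : (mixedSpace K)ˣ →* M) (c : (mixedSpace K)ˣ) :
    η c = (∏ w, η (realUnitAt K w (unitsFstAt c w))) * ∏ w, η (complexUnitAt K w (unitsSndAt c w)) := by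
  conv_lhs => rw [units_eq_prod_coordUnits c]
  rw [map_mul, map_prod, map_prod]

end CoordUnits


/-! ### Almost every point of `K_∞` is a unit -/

/-- The coordinate hyperplane `{x_w = 0}` at a complex place is Lebesgue-null. [folklore] -/
theorem volume_setOf_snd_eq_zero (w : {w : InfinitePlace K // IsComplex w}) :
    volume {x : mixedSpace K | x.2 w = 0} = 0 := by
  let L : mixedSpace K →ₗ[ℝ] ℂ := (LinearMap.proj w).comp (LinearMap.snd ℝ _ _)
  have hker : {x : mixedSpace K | x.2 w = 0} = (LinearMap.ker L : Set (mixedSpace K)) := by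
    ext x; simp [L]
  have hne : LinearMap.ker L ≠ ⊤ := by
    intro h
    have h1 : ((fun _ => (0 : ℝ), fun _ => (1 : ℂ)) : mixedSpace K) ∈ LinearMap.ker L := h ▸ Submodule.mem_top
    simp [L] at h1
  rw [hker]
  exact Measure.addHaar_submodule volume _ hne

/-- The coordinate hyperplane `{x_w = 0}` at a real place is Lebesgue-null (Mathlib
`mixedEmbedding.volume_eq_zero`, restated through a kernel for uniformity). [folklore] -/
theorem volume_setOf_fst_eq_zero (w : {w : InfinitePlace K // IsReal w}) :
    volume {x : mixedSpace K | x.1 w = 0} = 0 :=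
  mixedEmbedding.volume_eq_zero w

/-- **Almost every point of `K_∞` is a unit** (the non-units are the finitely many coordinate
hyperplanes). [folklore] -/
theorem ae_isUnit_mixedSpace : ∀ᵐ x : mixedSpace K, IsUnit x := by
  have h1 : ∀ᵐ x : mixedSpace K, ∀ w : {w : InfinitePlace K // IsReal w}, x.1 w ≠ 0 := by
    rw [ae_all_iff]
    intro w
    rw [ae_iff]
    simpa using volume_setOf_fst_eq_zero K w
  have h2 : ∀ᵐ x : mixedSpace K, ∀ w : {w : InfinitePlace K // IsComplex w}, x.2 w ≠ 0 := by
    rw [ae_all_iff]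
    intro w
    rw [ae_iff]
    simpa using volume_setOf_snd_eq_zero K w
  filter_upwards [h1, h2] with x hx1 hx2
  refine Prod.isUnit_iff.mpr ⟨Pi.isUnit_iff.mpr fun w => ?_, Pi.isUnit_iff.mpr fun w => ?_⟩
  · exact isUnit_iff_ne_zero.mpr (hx1 w)
  · exact isUnit_iff_ne_zero.mpr (hx2 w)

/-! ### Bochner integrals against a Haar measure of `K_∞ˣ` -/

attribute [local instance] Literature.MeasureTheory.Group.Units.borelSpace_of_isOpenEmbedding
  Literature.MeasureTheory.Group.hasSummableGeomSeries_of_finiteDimensional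

/-- **`∫_{K_∞ˣ} G(u) d^×u = ∫_{K_∞} G(x) N(x)⁻¹ dx`** for the reference Haar measure
`mixedUnitsHaar K = dx / N(x)` and every `G : K_∞ → E` (Bochner integrals; both sides are `0` when
`G` is not integrable). [cite: CasselsFrohlichANT1967, Ch. XV (Tate), §2.2] -/
theorem integral_mixedUnitsHaar {E : Type*} [NormedAddCommGroup E] [NormedSpace ℝ E]
    (G : mixedSpace K → E) :
    ∫ u, G (u : mixedSpace K) ∂mixedUnitsHaar K = ∫ x, (mixedEmbedding.norm x)⁻¹ • G x := by
  have hval := (Literature.MeasureTheory.Group.measurableEmbedding_unitsVal (A := mixedSpace K))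
  rw [← hval.integral_map G, mixedUnitsHaar, Literature.MeasureTheory.Group.unitsHaarOfAddHaar,
    hval.map_comap, Literature.MeasureTheory.Group.range_unitsVal_eq,
    restrict_withDensity Units.isOpen.measurableSet,
    integral_withDensity_eq_integral_toReal_smul Literature.MeasureTheory.Group.measurable_unitsDensity
      (Filter.Eventually.of_forall fun x => by
        rw [Literature.MeasureTheory.Group.unitsDensity_apply]; exact ENNReal.ofReal_lt_top),
    Measure.restrict_eq_self_of_ae_mem (μ := volume) (s := {x : mixedSpace K | IsUnit x})
      (ae_isUnit_mixedSpace K)]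
  refine integral_congr_ae ?_
  filter_upwards [ae_isUnit_mixedSpace K] with x hx
  rw [unitsDensity_eq_of_isUnit K hx, ENNReal.toReal_inv, ENNReal.toReal_ofReal (mixedEmbedding.norm_nonneg _)]

/-- **Every Haar measure `μ` on `K_∞ˣ` is `c · dx/N(x)`**: there is `c > 0` with
`∫_{K_∞ˣ} G(u) dμ(u) = c · ∫_{K_∞} G(x) N(x)⁻¹ dx` for every `G`. [folklore] -/
theorem exists_integral_units_eq_mul_integral (μ : Measure (mixedSpace K)ˣ) [μ.IsHaarMeasure] :
    ∃ c : ℝ, 0 < c ∧ ∀ {E : Type} [NormedAddCommGroup E] [NormedSpace ℝ E] (G : mixedSpace K → E),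
      ∫ u, G (u : mixedSpace K) ∂μ = c • ∫ x, (mixedEmbedding.norm x)⁻¹ • G x := by
  refine ⟨(μ.haarScalarFactor (mixedUnitsHaar K) : ℝ),
    NNReal.coe_pos.mpr (haarScalarFactor_pos_of_isHaarMeasure μ (mixedUnitsHaar K)), ?_⟩
  intro E _ _ G
  conv_lhs => rw [isMulLeftInvariant_eq_smul μ (mixedUnitsHaar K)]
  rw [integral_smul_nnreal_measure, ← integral_mixedUnitsHaar K G]
  rfl

/-! ### Product formula on `K_∞ = ℝ^{r₁} × ℂ^{r₂}` -/

/-- **Fubini on `K_∞`**: `∫_{K_∞} ∏_w f_w(x_w) ∏_w g_w(z_w) dx = ∏_w ∫_ℝ f_w · ∏_w ∫_ℂ g_w`.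
[folklore] -/
theorem integral_mixedSpace_prod_eq_prod (f : {w : InfinitePlace K // IsReal w} → ℝ → ℂ)
    (g : {w : InfinitePlace K // IsComplex w} → ℂ → ℂ) :
    ∫ x : mixedSpace K, (∏ w, f w (x.1 w)) * ∏ w, g w (x.2 w) =
      (∏ w, ∫ t : ℝ, f w t) * ∏ w, ∫ z : ℂ, g w z := by
  rw [MeasureTheory.Measure.volume_eq_prod,
    integral_prod_mul (fun a : {w : InfinitePlace K // IsReal w} → ℝ => ∏ w, f w (a w))
      (fun b : {w : InfinitePlace K // IsComplex w} → ℂ => ∏ w, g w (b w)),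
    integral_fintype_prod_volume_eq_prod, integral_fintype_prod_volume_eq_prod]

/-! ### Radial integrals on `ℂ` -/

/-- **Polar coordinates for a radial function on `ℂ`**: `∫_ℂ H(|z|) dx dy = 2π ∫₀^∞ r H(r) dr`.
[folklore] -/
theorem integral_complex_radial (H : ℝ → ℂ) :
    ∫ z : ℂ, H ‖z‖ = 2 * Real.pi * ∫ r in Ioi (0 : ℝ), (r : ℂ) * H r := by
  rw [← Complex.integral_comp_polarCoord_symm, polarCoord_target]
  have hpol : EqOn (fun p : ℝ × ℝ => p.1 • H ‖Complex.polarCoord.symm p‖)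
      (fun p : ℝ × ℝ => ((p.1 : ℂ) * H p.1) * (fun _ : ℝ => (1 : ℂ)) p.2) (Ioi (0 : ℝ) ×ˢ Ioo (-Real.pi) Real.pi) := by
    intro p hp
    simp only []
    rw [Complex.norm_polarCoord_symm, abs_of_pos (mem_prod.mp hp).1, Complex.real_smul, mul_one]
  rw [setIntegral_congr_fun (measurableSet_Ioi.prod measurableSet_Ioo) hpol, Measure.volume_eq_prod,
    setIntegral_prod_mul (fun r : ℝ => (r : ℂ) * H r) (fun _ : ℝ => (1 : ℂ))]
  have hθ : ∫ _ in Ioo (-Real.pi) Real.pi, (1 : ℂ) = 2 * Real.pi := by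
    rw [setIntegral_const, Measure.real, Real.volume_Ioo, Complex.real_smul, mul_one,
      ENNReal.toReal_ofReal (by linarith [Real.pi_pos])]
    push_cast
    ring
  rw [hθ, mul_comm]

/-- **The complex Tate integral with a Gaussian of parameter `b`**:
`∫_ℂ (|z|²)^{a-1} e^{-b|z|²} dx dy = π b^{-a} Γ(a)` for `re a > 0`, `b > 0`
(polar coordinates and `u = r²`; Tate (1967), §2.5, `k` complex, with `2π` replaced by `b`).
[cite: TateThesis1967, §2.5 (k complex), Cassels–Fröhlich p. 345] -/
theorem integral_complex_normSq_cpow_mul_exp {a : ℂ} (ha : 0 < a.re) {b : ℝ} (hb : 0 < b) :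
    ∫ z : ℂ, (((‖z‖ ^ 2 : ℝ)) : ℂ) ^ (a - 1) * Complex.exp (-b * (((‖z‖ ^ 2 : ℝ)) : ℂ)) =
      Real.pi * ((1 / b : ℂ) ^ a * Complex.Gamma a) := by
  set g : ℝ → ℂ := fun u => (u : ℂ) ^ (a - 1) * Complex.exp (-(b * (u : ℂ))) with hg
  have hH : (fun z : ℂ => (((‖z‖ ^ 2 : ℝ)) : ℂ) ^ (a - 1) * Complex.exp (-b * (((‖z‖ ^ 2 : ℝ)) : ℂ))) =
      fun z : ℂ => (fun r : ℝ => g (r ^ 2)) ‖z‖ := by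
    funext z
    simp only [hg, Complex.ofReal_pow, neg_mul]
  rw [hH, integral_complex_radial (fun r : ℝ => g (r ^ 2))]
  -- `u = r²`
  have key := integral_comp_rpow_Ioi g two_ne_zero
  have hL : EqOn (fun r : ℝ => (|(2 : ℝ)| * r ^ ((2 : ℝ) - 1)) • g (r ^ (2 : ℝ)))
      (fun r : ℝ => 2 * ((r : ℂ) * g (r ^ 2))) (Ioi 0) := by
    intro r hr
    simp only []
    rw [abs_of_pos two_pos, show (2 : ℝ) - 1 = 1 by norm_num, Real.rpow_one, Real.rpow_two,
      Complex.real_smul]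
    push_cast
    ring
  have h2 : ∫ r in Ioi (0 : ℝ), (r : ℂ) * g (r ^ 2) = 1 / 2 * ∫ u in Ioi (0 : ℝ), g u := by
    rw [← key, setIntegral_congr_fun measurableSet_Ioi hL, integral_const_mul]
    ring
  have h3 : ∫ u in Ioi (0 : ℝ), g u = (1 / b : ℂ) ^ a * Complex.Gamma a := by
    simp only [hg]
    exact Complex.integral_cpow_mul_exp_neg_mul_Ioi ha hb
  rw [h2, h3]
  ring

end Literature.NumberTheory.Automorphic
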